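import Mathlib.RingTheory.Length
import Mathlib.Topology.Semicontinuity.Defs
import Literature.AlgebraicGeometry.Hironaka2017.S04CharAlgebra.R005bEdgeData
import Literature.AlgebraicGeometry.Hironaka2017.EdgeHilbert
import HarnessLib

/-!
# [OURS · L1 W3.1] The edge-algebra Hilbert-function lemmas behind «u.s.c. of Inv» — campaign STATEMENTS
# `CampaignW31EdgeHilbLsc`, `CampaignW31EdgeHilbDictionary`, `CampaignW31EdgeHilbFiniteRange` (slot W3.1, seat res-L1-s31-pv-2)

Cell `res-hironaka`, rung L, slot W3.1 «u.s.c. first» (positive rung, verdict-free); companion of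
`Theorems/MarkedTransferCampaignW31UscInvOneExponent.lean` (p461513/p463247: the slot statement `CampaignW31UscInvOneExponentI p`).
ledger/group-3/DOSSIER.md §1 R13 / §4 names the intended OURS ARGUMENT for the slot statement: «u.s.c. of the Hilbert function of the
fibre algebras ν(℘(E))(ξ) along Sing (coherence + Nakayama) composed with `EdgeHilbert.EdgeInv.key_le_of_hilb_le`»; the tree's
`Literature/AlgebraicGeometry/Hironaka2017/EdgeHilbert.lean` (kernel-checked combinatorial core) lists as the inputs left OUTSIDE the
kernel exactly: (i) lower semicontinuity of `ξ ↦ dim_κ G(ξ)_a`, (ii) the dictionary `dim_κ G(ξ)_a = N(q(ξ); a)` between the edge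
algebra and the edge exponents, (iii) finitely many Hilbert functions occur. This file TYPES (i)–(iii) over OUR carriers as the
targets of seat res-L1-s31-pv-2 (L1 roster: «prove the edge-algebra Hilbert-function semicontinuity lemma the general statement
needs»); seat pv-3 assembles the slot statement from them. Typed by the OURS typer o4; host (custody) = the existing crux
`Theses.MarkedTransfer.HypersurfaceOrderReduction` stmt-16155, as the companion file. Nothing is proved here.

HONEST FRAMING. Every declaration below is OURS or plumbing; NOTHING here is a statement of H. Hironaka's manuscript *Resolution of
singularities in positive characteristics* (2017-03-23, [Hironaka2017], lit key `paper:url-3343fd9e678b`) and nothing here asserts that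
any statement of that manuscript holds. The manuscript offers no argument for the semicontinuity it uses (p.86 l.7–10; GAP-LEDGER
R13); the objects below are read off its Def. 4.6 p.19 l.33–37 («ν : bl_ξ(Z) → bl_ξ(Z)/max(O_ξ)bl_ξ(Z)», the edge algebra
`℘̄(E)(ξ) = ν(℘(E)_ξ)`, typed `S04CharAlgebra.nu` / `edgeAlgebra`) and Eq. (34) p.24 (`S04CharAlgebra.inv`).

## What is typed

* `CampaignW31.edgePiece E ξ a` — the degree-`a` piece `G(ξ)_a` of the edge algebra as a submodule of `O_ξ / 𝔪_ξ^{a+1}`: the image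
  of `℘(E,a)_ξ ∩ 𝔪_ξ^a` (row 003's `pAlg`, tree `Resolution.stalkIdeal`) in `𝔪_ξ^a / 𝔪_ξ^{a+1} ⊆ O_ξ / 𝔪_ξ^{a+1}` — i.e. `ν(℘(E,a)_ξ)` in
  degree `a` (Def. 4.6), choice-free (no coordinates `z̄`).
* `CampaignW31.edgeHilbAt E ξ a : ℕ∞` — its length as an `O_ξ`-module (= `dim_{κ(ξ)} G(ξ)_a`, the module being killed by `𝔪_ξ`):
  the HILBERT FUNCTION OF THE EDGE ALGEBRA at `ξ`.
* `CampaignW31EdgeHilbLsc p` — (i): for every perfect `K` of characteristic `p`, ambient datum `A`, standard `E` and degree `a`,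
  `ξ ↦ edgeHilbAt E ξ a` is LOWER semicontinuous on `Sing(E)_cl` (Mathlib `LowerSemicontinuousOn`, subspace of `Z`).
* `CampaignW31EdgeHilbDictionary p` — (ii): at a closed point of `Sing(E)`, for every edge data `D` with the Def. 4.9 provenance
  (`S04CharAlgebra.IsEdgeData`, row 005 part b), `edgeHilbAt E ξ a = N(q(D); a)` for all `a` — `N(q; a) = #{m ∈ ℕ^r | Σ m_j q_j = a}` is
  the tree's `EdgeHilbert.hilb` (the Hilbert function of `κ[ℓ_1^{q_1}, …, ℓ_r^{q_r}]`, property (8) p.19 / Eq. (25) p.21).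
* `CampaignW31EdgeHilbFiniteRange p` — (iii): only finitely many functions `a ↦ edgeHilbAt E ξ a` occur as `ξ` ranges over
  `Sing(E)_cl`.

## Vacuity self-check (for the lanes)
* (i) is a genuine condition (it fails for a non-coherent family of ideals; its intended proof uses F-21f coherence of `℘(E)`, to be
  consumed as a NAMED hypothesis by the prover, not built in here); (ii) is inhabited-dependent on `IsEdgeData` exactly like the
  companion file's `…I` slices (review p457701 → p460257) and is the ONE place where the combinatorics of `EdgeHilbert.lean` meets the
  typed edge algebra; (iii) is false for arbitrary families and true in the intended situation by finite generation of `℘(E)` (F-21f).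
  None is trivially true; no hypothesis is contradictory. Per-`p` slices (every OURS `Prop` of this directory takes `p`).

## References (context only)
* H. Hironaka, ms. 2017-03-23, Def. 4.6 p.19 l.33–37; (8) p.19; Def. 4.9 p.20 l.31–35; Eq. (25) p.21; Eq. (34) p.24; p.86 l.7–10.
  [Hironaka2017]
* V. Cossart, U. Jannsen, S. Saito, LNM 2270 (2020), Lemma 2.34 (u.s.c. + finitely many values on Noetherian spaces — pattern).
  [CossartJannsenSaito2020]
-/

noncomputable section

set_option linter.dupNamespace false -- mandated namespace of this single-conjunct summit

open _root_.AlgebraicGeometry _root_.TopologicalSpace _root_.IsLocalRing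

namespace Summit.ResolutionOfSingularities.ResolutionOfSingularities.Theorems

open Literature.AlgebraicGeometry.Resolution
open Literature.AlgebraicGeometry.Hironaka2017
open Literature.AlgebraicGeometry.Hironaka2017.S02Preliminaries
open Literature.AlgebraicGeometry.Hironaka2017.S04CharAlgebra

universe u

namespace CampaignW31

variable {Z : Scheme.{u}}

/-- [OURS · L1 W3.1] replaces the role of the degree-`a` piece of the edge algebra `℘̄(E)(ξ) = ν(℘(E)_ξ)` (Def. 4.6 p.19 l.33–37,
typed `S04CharAlgebra.edgeAlgebra`), choice-free: the image of `℘(E,a)_ξ ∩ 𝔪_ξ^a` (row 003's `pAlg E a`, stalk via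
`Resolution.stalkIdeal`) in `O_ξ / 𝔪_ξ^{a+1}` — a copy of `G(ξ)_a ⊆ 𝔪_ξ^a/𝔪_ξ^{a+1}`. NOT a statement of the manuscript. [folklore] -/
def edgePiece (E : IdealExponent Z) (ξ : Z) (a : ℕ) :
    Submodule (Z.presheaf.stalk ξ) (Z.presheaf.stalk ξ ⧸ maximalIdeal (Z.presheaf.stalk ξ) ^ (a + 1)) :=
  Submodule.map (maximalIdeal (Z.presheaf.stalk ξ) ^ (a + 1)).mkQ
    (stalkIdeal (pAlg E a) ξ ⊓ maximalIdeal (Z.presheaf.stalk ξ) ^ a)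

/-- [OURS · L1 W3.1] replaces the role of «the Hilbert function of the edge algebra at `ξ`» (implicit in Def. 4.6–4.9 pp.19–20; the
quantity the DOSSIER R13 argument varies along `Sing(E)`): `dim_{κ(ξ)} G(ξ)_a`, typed as the LENGTH of the `O_ξ`-module
`edgePiece E ξ a` (Mathlib `Module.length`, value in `ℕ∞`; the module is killed by `𝔪_ξ`, so its length is its `κ(ξ)`-dimension).
NOT a statement of the manuscript. [folklore] -/
def edgeHilbAt (E : IdealExponent Z) (ξ : Z) (a : ℕ) : ℕ∞ :=
  Module.length (Z.presheaf.stalk ξ) ↥(edgePiece E ξ a)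

end CampaignW31

open CampaignW31

/-- **[OURS · L1 W3.1] `CampaignW31EdgeHilbLsc p` — the EDGE-ALGEBRA HILBERT-FUNCTION SEMICONTINUITY LEMMA** (seat res-L1-s31-pv-2;
input (i) of the OURS argument for the slot statement, DOSSIER group-3 §1 R13): for every perfect field `K` of characteristic `p`,
ambient datum `A` (row 001), STANDARD ideal exponent `E` on `A.Z` and degree `a`, the function `ξ ↦ dim_{κ(ξ)} G(ξ)_a`
(`CampaignW31.edgeHilbAt E ξ a`) is LOWER semicontinuous on the closed points of `Sing(E)` (subspace topology). Replaces the role of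
the missing argument behind p.86 l.7–10; NOT a statement of the manuscript. Intended proof: principal parts of order `a` + Nakayama,
CONSUMING the coherence of `℘(E,a)` (FACT-LIST F-21f, [23]) as a named hypothesis. [folklore] -/
def CampaignW31EdgeHilbLsc (p : ℕ) [Fact p.Prime] : Prop :=
  ∀ (K : Type u) [Field K] [CharP K p] [PerfectField K] (A : AmbientDatum p K) (E : IdealExponent A.Z),
    E.IsStandard → ∀ a : ℕ,
      LowerSemicontinuousOn (fun ξ => edgeHilbAt E ξ a) (E.sing ∩ S02Preliminaries.closedPoints A.Z)

/-- **[OURS · L1 W3.1] `CampaignW31EdgeHilbDictionary p` — the DICTIONARY between the edge algebra and the edge exponents** (input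
(ii)): for every perfect `K` of characteristic `p`, ambient datum `A`, `n`, STANDARD `E`, closed point `ξ ∈ Sing(E)` and edge data
`D : EdgeDatumAt p n E ξ` with the Def. 4.9 provenance AS TYPED (`S04CharAlgebra.IsEdgeData`, row 005 part b: homogeneous lifts of a
minimum system of homogeneous generators `ḡ_j`, `deg ḡ_j = q_j`), and every degree `a`:
`dim_{κ(ξ)} G(ξ)_a = N(q(D); a)`, where `N(q; a) = #{m ∈ ℕ^r | Σ_j m_j q_j = a}` is the tree's `EdgeHilbert.hilb (EdgeDatum.q D) a` — the
Hilbert function of `κ[ℓ_1^{q_1}, …, ℓ_r^{q_r}]` with independent linear forms `ℓ_j` (property (8) p.19 l.27–30, Eq. (25) p.21 l.2–3).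
Replaces the role of that identification (used silently whenever the manuscript reads `(r; q)` off the edge algebra); NOT a statement
of the manuscript. Its intended proof uses Th. 4.1 (2) Diff-stability (typed candidate `S04CharAlgebra.Thm4_1_2`, a hypothesis) and the
tree theorem `Resolution/DiffStableSubalgebra.exists_eq_adjoin_pow_linearForms_of_isDiffStable` (K perfect). [folklore] -/
def CampaignW31EdgeHilbDictionary (p : ℕ) [Fact p.Prime] : Prop :=
  ∀ (K : Type u) [Field K] [CharP K p] [PerfectField K] (A : AmbientDatum p K) (n : ℕ) (E : IdealExponent A.Z),
    E.IsStandard → ∀ ξ ∈ E.sing ∩ S02Preliminaries.closedPoints A.Z, ∀ D : EdgeDatumAt p n E ξ,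
      S04CharAlgebra.IsEdgeData D → ∀ a : ℕ, edgeHilbAt E ξ a = (EdgeHilbert.hilb (EdgeDatum.q D) a : ℕ∞)

/-- **[OURS · L1 W3.1] `CampaignW31EdgeHilbFiniteRange p` — FINITELY MANY HILBERT FUNCTIONS** (input (iii); the finiteness under
which u.s.c. ⇔ the CJS conditions, tree `Literature/Topology/NoetherianSpaces/UpperSemicontinuous.lean`): for every perfect `K` of
characteristic `p`, ambient datum `A` and STANDARD `E` on `A.Z`, the set of functions `a ↦ dim_{κ(ξ)} G(ξ)_a`, `ξ ∈ Sing(E)_cl`, is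
finite. Replaces the role of the boundedness the manuscript asserts at p.87 l.11–14 («the maximum degree of the edge generators are
bounded», typed `S16Proof.U87_2`) in its single-exponent form; NOT a statement of the manuscript. Intended proof: finite generation of
`℘(E)` (F-21f) bounds the generator degrees. [folklore] -/
def CampaignW31EdgeHilbFiniteRange (p : ℕ) [Fact p.Prime] : Prop :=
  ∀ (K : Type u) [Field K] [CharP K p] [PerfectField K] (A : AmbientDatum p K) (E : IdealExponent A.Z),
    E.IsStandard →
      (Set.range fun ξ : ↥(E.sing ∩ S02Preliminaries.closedPoints A.Z) => fun a : ℕ => edgeHilbAt E (ξ : A.Z) a).Finite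

end Summit.ResolutionOfSingularities.ResolutionOfSingularities.Theorems

end
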